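import Literature.Probability.RandomPlanarGeometry.HexSAWArmchairWallBridges
import HarnessLib

/-!
# Honeycomb SAW at Beaton's ROTATED (armchair) surface: `β_rot(y) > √y` STRICTLY, for every `y > 0`
# (`y⁸ + y⁶ ≤ B^w_13(y) ≤ β_rot(y)^16`)

Topic `Literature/Probability/RandomPlanarGeometry` (lane «pcv-sawmu», rotated-door lineage, rider «ARM-SQRT-STRICT»; continues
`HexSAWArmchairWallBridges.lean` — `wb`, `WB`, `visits`, the Fekete rate `armRate y = β_rot(y)` with `wseq_le_pow : d_k ≤ (β_rot⁴)^k`,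
`d_k = B^w_{4k-3}(y)`; companion of `HexSAWArmchairSqrtAsymptotic.lean` (`β_rot(y) ≤ √y/(1 − 109/√y)`), which gives the matching upper side).

Sources. N. R. Beaton, J. Phys. A 47 (2014) 075003 = arXiv:1210.0274v3, §3.1, Proposition 7 (p. 11: "for any `y > 0`, `μ(y) ≥ max{μ, √y}`";
p. 14: "the lower bound `μ(y) ≥ √y` is obtained by considering walks which step along the surface").  N. Madras, G. Slade, *The Self-Avoiding
Walk* (1993), §1.2 (Lemma 1.2.2 p. 9; (1.2.17) p. 11: `b_n ≤ μ_Bridge^n`).  I. G. Enting, I. Jensen, LNP 775 (2009), §7.4.2, Fig. 7.10 (brickwork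
form of the honeycomb lattice).

## What is proved (namespace `…SAW.HexBW.Arm`)

Two explicit armchair wall bridges of length `13` — the surface zig-zag `Thirteen.zw` (8 wall vertices) and the one-brick detour
`Thirteen.dw = (0,0),(0,1),(1,1),(2,1),(3,1),(3,2),(2,2),(1,2),(0,2),(0,3),(1,3),(1,4),(0,4),(0,5)` (6 wall vertices; coordinates checked by
`decide`, memberships discharged inline — see the design note in `HexSAWArmchairWallBridgeOddRate.lean`) — give
**`pow_add_pow_le_WB_thirteen : y⁸ + y⁶ ≤ B^w_13(y)`** (`y ≥ 0`), hence by Fekete (`d_4 = B^w_13 ≤ β_rot^16`)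
**`pow_add_pow_le_armRate_pow : y⁸ + y⁶ ≤ β_rot(y)^16`** and **`sqrt_lt_armRate : √y < β_rot(y)`** for EVERY `y > 0`: Beaton's printed
`μ(y) ≥ √y` is STRICT throughout (the adsorbed phase is never frozen onto the zig-zag), quantitatively `β_rot(y) ≥ √y · (1 + y⁻²)^{1/16}`
(`armRate_pow_sixteen_ge`).  (Design enumeration, not used: `B^w_13(y) = y⁸ + 4y⁶ + 8y⁴`; wall visits of a wall bridge come in dimer pairs,
so the first correction to the zig-zag weight `y^{(n+3)/2}` is at `y^{(n+3)/2 − 2}`.)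

Status in print: Beaton prints the weak inequality only (pp. 11, 14); strictness for every `y` and the explicit correction are not printed
(elementary).  LABEL (author's proposal): CONSOLIDATION + XS (strict form of a printed inequality, by two explicit walks).
-/

noncomputable section

open Finset Filter Function
open Literature.Probability.LatticeModels Literature.Probability.Percolation SimpleGraph
open _root_.Topology

namespace Literature.Probability.RandomPlanarGeometry.SAW.HexBW.Arm

variable {y : ℝ} {n : ℕ}

namespace Thirteen

/-- Brick-wall adjacency as a Boolean test on coordinates (private twin of `OddBridge.adjB` of `HexSAWArmchairWallBridgeOddRate.lean`, kept here
so that this file imports Part A6 only). [cite: EntingJensen2009, §7.4.2, Fig. 7.10 (brickwork form of the honeycomb lattice)] -/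
def adjT (a b c d : ℤ) : Bool :=
  ((c = a + 1 ∨ a = c + 1) ∧ d = b) ∨ (c = a ∧ ((d = b + 1 ∧ (a + b) % 2 = 0) ∨ (b = d + 1 ∧ (c + d) % 2 = 0)))

/-- The Boolean test is sound. [cite: EntingJensen2009, §7.4.2, Fig. 7.10 (brickwork form of the honeycomb lattice)] -/
private theorem adj_of_adjT {a b c d : ℤ} (h : adjT a b c d = true) : brickWallGraph.Adj (pt a b) (pt c d) := by
  rw [brickWallGraph_adj_coord]
  simpa [adjT, pt_apply_zero, pt_apply_one] using h

/-- `X`-coordinates of the 13-step surface zig-zag (frozen value `0` after time 13). [cite: Beaton2014RotatedHoneycomb, §3.1 (arXiv v3 p. 14: "walks which step along the surface")] -/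
def zX : ℕ → ℤ
  | 2 => 1 | 3 => 1 | 6 => 1 | 7 => 1 | 10 => 1 | 11 => 1 | _ => 0

/-- `Y`-coordinates of the 13-step surface zig-zag (frozen value `7` after time 13). [cite: Beaton2014RotatedHoneycomb, §3.1 (arXiv v3 p. 14)] -/
def zY : ℕ → ℤ
  | 0 => 0 | 1 => 1 | 2 => 1 | 3 => 2 | 4 => 2 | 5 => 3 | 6 => 3 | 7 => 4 | 8 => 4 | 9 => 5 | 10 => 5 | 11 => 6 | 12 => 6 | _ => 7

/-- `X`-coordinates of the 13-step one-brick detour (frozen value `0` after time 13). [cite: EntingJensen2009, §7.4.2, Fig. 7.10] -/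
def dX : ℕ → ℤ
  | 2 => 1 | 3 => 2 | 4 => 3 | 5 => 3 | 6 => 2 | 7 => 1 | 10 => 1 | 11 => 1 | _ => 0

/-- `Y`-coordinates of the 13-step one-brick detour (frozen value `5` after time 13). [cite: EntingJensen2009, §7.4.2, Fig. 7.10] -/
def dY : ℕ → ℤ
  | 0 => 0 | 1 => 1 | 2 => 1 | 3 => 1 | 4 => 1 | 5 => 2 | 6 => 2 | 7 => 2 | 8 => 2 | 9 => 3 | 10 => 3 | 11 => 4 | 12 => 4 | _ => 5

/-- **The 13-step surface zig-zag** `(0,0),(0,1),(1,1),(1,2),(0,2),…,(0,7)` (8 wall vertices). [cite: Beaton2014RotatedHoneycomb, §3.1 (arXiv v3 p. 14: "walks which step along the surface")] -/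
def zw (i : ℕ) : Site 2 := pt (zX (min i 13)) (zY (min i 13))

/-- **The 13-step one-brick detour** `(0,0),(0,1),(1,1),(2,1),(3,1),(3,2),(2,2),(1,2),(0,2),(0,3),(1,3),(1,4),(0,4),(0,5)` (6 wall vertices).
[cite: Beaton2014RotatedHoneycomb, §3.1, proof of Proposition 7 (arXiv v3 p. 12: unfolded walks)] -/
def dw (i : ℕ) : Site 2 := pt (dX (min i 13)) (dY (min i 13))

/-- Coordinate facts of the zig-zag, by `decide`: bonds, injectivity, half-plane, level window, end `(0,7)`. [cite: EntingJensen2009, §7.4.2, Fig. 7.10] -/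
theorem z_facts : (∀ i < 13, adjT (zX i) (zY i) (zX (i + 1)) (zY (i + 1)) = true) ∧
    (∀ i ≤ 13, ∀ j ≤ 13, zX i = zX j → zY i = zY j → i = j) ∧ (∀ i ≤ 13, 0 ≤ zX i) ∧
    (∀ i, 1 ≤ i → i < 13 → 0 < zY i ∧ zY i < 7) ∧ zX 13 = 0 ∧ zY 13 = 7 ∧ zX 0 = 0 ∧ zY 0 = 0 := by decide

/-- Coordinate facts of the detour, by `decide`: bonds, injectivity, half-plane, level window, end `(0,5)`. [cite: EntingJensen2009, §7.4.2, Fig. 7.10] -/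
theorem d_facts : (∀ i < 13, adjT (dX i) (dY i) (dX (i + 1)) (dY (i + 1)) = true) ∧
    (∀ i ≤ 13, ∀ j ≤ 13, dX i = dX j → dY i = dY j → i = j) ∧ (∀ i ≤ 13, 0 ≤ dX i) ∧
    (∀ i, 1 ≤ i → i < 13 → 0 < dY i ∧ dY i < 5) ∧ dX 13 = 0 ∧ dY 13 = 5 ∧ dX 0 = 0 ∧ dY 0 = 0 := by decide

/-- Membership components of the zig-zag (all in `∀`/`∧`/`=` form). [cite: MadrasSlade1993, §1.1; HammersleyTorrieWhittington1982, §2 (as summarised by Beaton 2014 arXiv v3 p. 11; locator provisional)] -/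
theorem zw_components : zw 0 = 0 ∧ (∀ i, 13 ≤ i → zw i = zw 13) ∧ IsBW 13 zw ∧ Set.InjOn zw {i | i ≤ 13} ∧ InH 13 zw ∧
    zw 13 0 = 0 ∧ IsWB 13 zw := by
  obtain ⟨hadj, hinj, hX, hY, hXe, hYe, hX0, hY0⟩ := z_facts
  refine ⟨?_, fun i hi => by simp only [zw, min_eq_right hi, min_self], fun i hi => ?_, fun i hi j hj hij => ?_, fun i _ => ?_, ?_, ?_, fun i hi1 hi => ?_⟩
  · rw [site_two_eq_iff]; simp only [zw, Nat.zero_min, pt_apply_zero, pt_apply_one, hX0, hY0]; exact ⟨rfl, rfl⟩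
  · simp only [zw, min_eq_left hi.le, min_eq_left (Nat.succ_le_of_lt hi)]; exact adj_of_adjT (hadj i hi)
  · simp only [Set.mem_setOf_eq] at hi hj
    have h0 := congrFun hij 0
    have h1 := congrFun hij 1
    simp only [zw, pt_apply_zero, pt_apply_one, min_eq_left hi, min_eq_left hj] at h0 h1
    exact hinj i hi j hj h0 h1
  · simp only [zw, pt_apply_zero]; exact hX _ (min_le_right _ _)
  · simp only [zw, pt_apply_zero, min_self]; exact hXe
  · simp only [zw, pt_apply_one, min_self]; rw [hYe]; norm_num
  · simp only [zw, pt_apply_one, min_self, min_eq_left hi.le]; rw [hYe]; exact hY i hi1 hi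

/-- Membership components of the detour. [cite: MadrasSlade1993, §1.1; HammersleyTorrieWhittington1982, §2 (as summarised by Beaton 2014 arXiv v3 p. 11; locator provisional)] -/
theorem dw_components : dw 0 = 0 ∧ (∀ i, 13 ≤ i → dw i = dw 13) ∧ IsBW 13 dw ∧ Set.InjOn dw {i | i ≤ 13} ∧ InH 13 dw ∧
    dw 13 0 = 0 ∧ IsWB 13 dw := by
  obtain ⟨hadj, hinj, hX, hY, hXe, hYe, hX0, hY0⟩ := d_facts
  refine ⟨?_, fun i hi => by simp only [dw, min_eq_right hi, min_self], fun i hi => ?_, fun i hi j hj hij => ?_, fun i _ => ?_, ?_, ?_, fun i hi1 hi => ?_⟩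
  · rw [site_two_eq_iff]; simp only [dw, Nat.zero_min, pt_apply_zero, pt_apply_one, hX0, hY0]; exact ⟨rfl, rfl⟩
  · simp only [dw, min_eq_left hi.le, min_eq_left (Nat.succ_le_of_lt hi)]; exact adj_of_adjT (hadj i hi)
  · simp only [Set.mem_setOf_eq] at hi hj
    have h0 := congrFun hij 0
    have h1 := congrFun hij 1
    simp only [dw, pt_apply_zero, pt_apply_one, min_eq_left hi, min_eq_left hj] at h0 h1
    exact hinj i hi j hj h0 h1
  · simp only [dw, pt_apply_zero]; exact hX _ (min_le_right _ _)
  · simp only [dw, pt_apply_zero, min_self]; exact hXe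
  · simp only [dw, pt_apply_one, min_self]; rw [hYe]; norm_num
  · simp only [dw, pt_apply_one, min_self, min_eq_left hi.le]; rw [hYe]; exact hY i hi1 hi

/-- Wall visits of the two walks: `8` and `6` (kernel evaluation). [cite: Beaton2014RotatedHoneycomb, §3.1 (arXiv v3 p. 11: "occupying m vertices in the surface")] -/
theorem visits_zw_dw : visits 13 zw = 8 ∧ visits 13 dw = 6 := by decide

/-- The two walks differ (at time `3`: `(1,2)` versus `(2,1)`). [cite: EntingJensen2009, §7.4.2, Fig. 7.10] -/
theorem zw_ne_dw : zw ≠ dw := fun h => by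
  have := congrFun (congrFun h 3) 0
  revert this
  decide

end Thirteen

open Thirteen in
/-- **`y⁸ + y⁶ ≤ B^w_13(y)`** (`y ≥ 0`): the 13-step zig-zag and the one-brick detour are two distinct armchair wall bridges with `8` and `6`
wall vertices. [cite: Beaton2014RotatedHoneycomb, §3.1, Proposition 7 (arXiv v3 p. 11: "μ(y) ≥ max{μ, √y}"; p. 14)] -/
theorem pow_add_pow_le_WB_thirteen (hy : 0 ≤ y) : y ^ 8 + y ^ 6 ≤ WB 13 y := by
  classical
  rw [WB]
  have hsub : ({zw, dw} : Finset (ℕ → Site 2)) ⊆ wb 13 := by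
    refine Finset.insert_subset_iff.2 ⟨?_, Finset.singleton_subset_iff.2 ?_⟩
    · rw [mem_wb, mem_arches, mem_hp, mem_saws_iff]
      obtain ⟨h0, hfr, hbw, hinj, hH, hend, hwb⟩ := zw_components
      exact ⟨⟨⟨⟨h0, hfr, hbw, hinj⟩, hH⟩, hend⟩, hwb⟩
    · rw [mem_wb, mem_arches, mem_hp, mem_saws_iff]
      obtain ⟨h0, hfr, hbw, hinj, hH, hend, hwb⟩ := dw_components
      exact ⟨⟨⟨⟨h0, hfr, hbw, hinj⟩, hH⟩, hend⟩, hwb⟩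
  obtain ⟨h8, h6⟩ := visits_zw_dw
  have hpair : ∑ ω ∈ ({zw, dw} : Finset (ℕ → Site 2)), y ^ visits 13 ω = y ^ 8 + y ^ 6 := by
    simp only [Finset.sum_pair zw_ne_dw, h8, h6]
  calc y ^ 8 + y ^ 6 = ∑ ω ∈ ({zw, dw} : Finset (ℕ → Site 2)), y ^ visits 13 ω := hpair.symm
    _ ≤ ∑ ω ∈ wb 13, y ^ visits 13 ω := Finset.sum_le_sum_of_subset_of_nonneg hsub fun _ _ _ => pow_nonneg hy _

/-- **`y⁸ + y⁶ ≤ β_rot(y)^16`** (`y > 0`): `B^w_13 = d_4 ≤ (β_rot⁴)⁴`. [cite: MadrasSlade1993, §1.2, (1.2.17) (p. 11: b_n ≤ μ_Bridge^n)] -/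
theorem pow_add_pow_le_armRate_pow (hy : 0 < y) : y ^ 8 + y ^ 6 ≤ armRate y ^ 16 := by
  have h := wseq_le_pow hy 4
  rw [wseq, if_neg (by norm_num), show 4 * 4 - 3 = 13 by norm_num, ← pow_mul, show 4 * 4 = 16 by norm_num] at h
  exact (pow_add_pow_le_WB_thirteen hy.le).trans h

/-- **`√y < β_rot(y)` for EVERY `y > 0`**: Beaton's `μ(y) ≥ √y` is strict. [cite: Beaton2014RotatedHoneycomb, Proposition 7 (arXiv v3 p. 11: "μ(y) ≥ max{μ, √y}" — strict form)] -/
theorem sqrt_lt_armRate (hy : 0 < y) : Real.sqrt y < armRate y := by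
  have hβ := armRate_pos y
  have h1 : Real.sqrt y ^ 16 < armRate y ^ 16 := by
    calc Real.sqrt y ^ 16 = y ^ 8 := by rw [show (16 : ℕ) = 2 * 8 by norm_num, pow_mul, Real.sq_sqrt hy.le]
      _ < y ^ 8 + y ^ 6 := lt_add_of_pos_right _ (pow_pos hy 6)
      _ ≤ armRate y ^ 16 := pow_add_pow_le_armRate_pow hy
  exact lt_of_pow_lt_pow_left₀ 16 hβ.le h1

/-- **Quantitative form**: `y⁸ (1 + y⁻²) ≤ β_rot(y)^16`, i.e. `β_rot(y) ≥ √y · (1 + y⁻²)^{1/16}`. [cite: Beaton2014RotatedHoneycomb, Proposition 7 (arXiv v3 p. 11)] -/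
theorem armRate_pow_sixteen_ge (hy : 0 < y) : y ^ 8 * (1 + (y ^ 2)⁻¹) ≤ armRate y ^ 16 := by
  have hy2 : y ^ 2 ≠ 0 := pow_ne_zero _ hy.ne'
  have e : y ^ 8 * (1 + (y ^ 2)⁻¹) = y ^ 8 + y ^ 6 := by
    rw [mul_add, mul_one, ← div_eq_mul_inv, show y ^ 8 / y ^ 2 = y ^ 6 from by rw [div_eq_iff hy2]; ring]
  rw [e]
  exact pow_add_pow_le_armRate_pow hy

end Literature.Probability.RandomPlanarGeometry.SAW.HexBW.Arm
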